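import Summits.NavierStokesRegularity.FluidComputer.TriggeredTransferEulerInstance
import Summits.NavierStokesRegularity.FluidComputer.TriggeredTransferRobustBounded

/-!
# Fluid computer, door N1-FC — the non-vacuity witness for ALL FOUR door typings: `Step`, `StepB`, `StepWithin`, `StepWithinB`

Cell `ns-blowup`, seat `ns-blowup-fc-prover-1` (g3; D-0074 GROUP C «bridge support»; LADDER-NS rung
N1-FC). Companion of `TriggeredTransferEulerInstance.lean` (this seat: the Gavrilov alphabet
`SteadyBlob.scheme : TriggerScheme` and `SteadyBlob.step_one : scheme.Step 0 1 1 (1 • G)`) and of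
seat `ns-blowup-fc-prover-2`'s square of door typings {exact `Step` / tolerance-robust `StepWithin`}
× {no ceiling / sup-ceiling on the piece: `StepB`, `StepWithinB`} (`TriggeredTransferBounded`,
`TriggeredTransferRobust`, `TriggeredTransferRobustBounded`). The typing that closes Fefferman's (C)
with ZERO named facts is the bounded one (`navierStokesBreakdownR3_of_exists_transfersB`,
`…_of_exists_transfersWithinB`); this file records that the SAME prescribed transplant inhabits the
one-step predicate of each of the four typings at `ν = 0`, `ε = 1` (the transplant is bounded by
`(1 + 2√2) sup ‖G‖`, and its hand-over slice is exactly a zoomed Clay member, tolerance `0`).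
LABEL: E–C typing / calibration.

WHAT THIS IS NOT: not Navier–Stokes evidence — a PRESCRIBED compactly supported forced EULER flow
whose force does the transfer; nothing about `Transfers ν` / `TransfersB ν` / `TransfersWithin(B)`
for any `ν` or small `ε` is claimed (module doc of `TriggeredTransferEulerInstance`, «Reading»).

## Contents (theorems only)

* `SteadyBlob.norm_flow_le` — the transplant is bounded on all of space–time;
* `SteadyBlob.flow_four` — its hand-over slice is `zoom 2 x₀ (√2 • G)`; `hasRapidSpatialDecay_flow_four`;
* `SteadyBlob.stepB_one : B.scheme.StepB 0 1 1 (1 • G)` (an explicit `Link` plus the ceiling),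
  `SteadyBlob.stepWithin_one : B.scheme.StepWithin 0 1 1 (1 • G) 0` (via fc-prover-2's
  `stepWithin_zero_of_step`), `SteadyBlob.stepWithinB_one : B.scheme.StepWithinB 0 1 1 (1 • G) 0`;
* `exists_stepB_inviscid_unit_trigger`, `exists_stepWithinB_inviscid_unit_trigger` — the packaged
  existentials.

0 sorry; axioms ⊆ {propext, Classical.choice, Quot.sound}. References: A. V. Gavrilov, Geom. Funct.
Anal. 29 (2019) §1 Theorem [cite: Gavrilov2019, §1 Theorem]; T. Tao, J. Amer. Math. Soc. 29 (2016)
§1.3 [cite: Tao2016AveragedNS, §1.3].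
-/

noncomputable section

namespace Summit.NavierStokesRegularity.FluidComputer.TriggeredTransfer

open Set MeasureTheory Function Filter Metric
open scoped ENNReal ContDiff NNReal Topology
open Literature.Analysis.FluidPDE
open Literature.Analysis.FluidPDE.FluidComputer (E3 Vel)

namespace SteadyBlob

variable (B : SteadyBlob)

/-- **The transplant is bounded** on all of space–time: `‖u t x‖ ≤ (1 - θ) sup ‖G‖ + θ sup ‖W₂‖
≤ (1 + 2√2) sup ‖G‖`. [folklore] -/
theorem norm_flow_le : ∃ M : ℝ, ∀ t x, ‖B.flow t x‖ ≤ M := by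
  obtain ⟨M, hM0, hM⟩ := B.exists_bound_G
  have hW₂ : ∀ x, ‖B.W₂ x‖ ≤ 2 * Real.sqrt 2 * M := fun x => by
    simp only [W₂, norm_smul, Real.norm_of_nonneg (show (0 : ℝ) ≤ 2 * Real.sqrt 2 by positivity)]
    exact mul_le_mul_of_nonneg_left (hM _) (by positivity)
  refine ⟨M + 2 * Real.sqrt 2 * M, fun t x => ?_⟩
  have h0 := fade_nonneg t
  have h1 := fade_le_one t
  calc ‖B.flow t x‖ ≤ ‖(1 - fade t) • B.G x‖ + ‖fade t • B.W₂ x‖ := norm_add_le _ _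
    _ = (1 - fade t) * ‖B.G x‖ + fade t * ‖B.W₂ x‖ := by
        rw [norm_smul, norm_smul, Real.norm_of_nonneg (by linarith), Real.norm_of_nonneg h0]
    _ ≤ (1 - fade t) * M + fade t * (2 * Real.sqrt 2 * M) :=
        add_le_add (mul_le_mul_of_nonneg_left (hM x) (by linarith))
          (mul_le_mul_of_nonneg_left (hW₂ x) h0)
    _ ≤ M + 2 * Real.sqrt 2 * M := by
        have e : (1 - fade t) * M = M - fade t * M := by ring
        have hθM : 0 ≤ fade t * M := mul_nonneg h0 hM0
        have h2 : fade t * (2 * Real.sqrt 2 * M) ≤ 2 * Real.sqrt 2 * M :=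
          mul_le_of_le_one_left (by positivity) h1
        linarith

/-- **The hand-over slice is a zoomed member**: `u 4 = zoom 2 x₀ (√2 • G)` (fc-prover-2's `zoom`).
[folklore] -/
theorem flow_four : B.flow 4 = zoom 2 B.x₀ (fun x => Real.sqrt 2 • B.G x) := by
  rw [B.flow_of_three_le (by norm_num)]
  funext x
  simp [W₂, zoom_apply, smul_smul]

/-- `√2 • G` is a member of the Gavrilov alphabet at amplitude `√2 ≥ U⋆ = 1`, hence a Clay datum.
[folklore] -/
theorem clay_sqrt_two : ContDiff ℝ ∞ (fun x => Real.sqrt 2 • B.G x) ∧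
    NSWave0.IsDivFree (fun x => Real.sqrt 2 • B.G x) ∧
    HasRapidSpatialDecay (fun x => Real.sqrt 2 • B.G x) := by
  have h1 : B.scheme.UStar ≤ Real.sqrt 2 := by
    show (1 : ℝ) ≤ Real.sqrt 2
    rw [show (1 : ℝ) = Real.sqrt 1 from Real.sqrt_one.symm]
    exact Real.sqrt_le_sqrt (by norm_num)
  exact B.scheme.clay (Real.sqrt 2) h1 _ rfl

/-- The hand-over slice decays rapidly (it is the zoom of a Clay member). [folklore] -/
theorem hasRapidSpatialDecay_flow_four : HasRapidSpatialDecay (B.flow 4) := by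
  rw [B.flow_four]
  exact hasRapidSpatialDecay_zoom B.clay_sqrt_two.1 B.clay_sqrt_two.2.2 two_pos B.x₀

/-- **`StepB` is inhabited (ν = 0, ε = 1)**: the transplant is an explicit `Link` of the Gavrilov
alphabet from `1 • G` (hand-over time `4`, margin `1`, trigger = the transplant force, hand-over to
`√2 • G` zoomed at `x₀`) AND it obeys a sup-ceiling on the whole slab — the one-step predicate of the
BOUNDED door typing `TransfersB` of seat `ns-blowup-fc-prover-2` (the typing that closes (C) with
zero named facts). Prescribed flow; the force does the transfer. [folklore] -/
theorem stepB_one : B.scheme.StepB 0 1 1 (fun x => (1 : ℝ) • B.G x) := by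
  obtain ⟨M, hM⟩ := B.norm_flow_le
  refine ⟨⟨4, 1, B.trig, B.flow, B.pres, Real.sqrt 2, fun x => Real.sqrt 2 • B.G x, B.x₀, one_pos,
    by norm_num, ?_, B.isTrigger_trig, B.flow_classical, B.flow_zero, B.flow_energy, ?_, rfl, ?_, ?_⟩,
    M, fun t _ x => hM t x⟩
  · simp [scheme]
  · rw [growth_scheme, mul_one]
  · simp [scheme, norm_x₀]
  · rw [B.flow_of_three_le (by norm_num)]
    funext x
    simp [W₂, scheme, smul_smul]

/-- **`StepWithin` (tolerance `0`) is inhabited (ν = 0, ε = 1)** — from `step_one` by fc-prover-2's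
`stepWithin_zero_of_step`. [folklore] -/
theorem stepWithin_one : B.scheme.StepWithin 0 1 1 (fun x => (1 : ℝ) • B.G x) 0 :=
  TriggerScheme.stepWithin_zero_of_step le_rfl B.step_one

/-- **`StepWithinB` (tolerance `0`, with ceiling) is inhabited (ν = 0, ε = 1)**: the clauses of the
transplant's `Step`, the rapid decay of the hand-over slice (a zoomed Clay member), the sup-ceiling,
and hand-over error `0`. [folklore] -/
theorem stepWithinB_one : B.scheme.StepWithinB 0 1 1 (fun x => (1 : ℝ) • B.G x) 0 := by
  obtain ⟨M, hM⟩ := B.norm_flow_le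
  refine ⟨4, 1, B.trig, B.flow, B.pres, one_pos, by norm_num, ?_, B.isTrigger_trig, B.flow_classical,
    B.flow_zero, B.flow_energy, B.hasRapidSpatialDecay_flow_four, ⟨M, fun t _ x => hM t x⟩,
    Real.sqrt 2, fun x => Real.sqrt 2 • B.G x, B.x₀, ?_, rfl, ?_, fun x => ?_⟩
  · simp [scheme]
  · rw [growth_scheme, mul_one]
  · simp [scheme, norm_x₀]
  · have hlam : B.scheme.lam = 2 := rfl
    rw [hlam, B.flow_four, sub_self, norm_zero, zero_mul]

end SteadyBlob

/-! ## Packaged existentials -/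

/-- **The bounded door's one-step predicate is inhabited at zero viscosity with a unit trigger.**
[folklore] -/
theorem exists_stepB_inviscid_unit_trigger :
    ∃ (𝒮 : TriggerScheme) (U : ℝ) (w : Vel), 𝒮.UStar ≤ U ∧ w ∈ 𝒮.F U ∧ 𝒮.StepB 0 U 1 w := by
  obtain ⟨B⟩ := SteadyBlob.nonempty
  exact ⟨B.scheme, 1, fun x => (1 : ℝ) • B.G x, le_rfl, rfl, B.stepB_one⟩

/-- **The robust-bounded door's one-step predicate (tolerance `0`) is inhabited at zero viscosity
with a unit trigger.** [folklore] -/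
theorem exists_stepWithinB_inviscid_unit_trigger :
    ∃ (𝒮 : TriggerScheme) (U : ℝ) (w : Vel), 𝒮.UStar ≤ U ∧ w ∈ 𝒮.F U ∧ 𝒮.StepWithinB 0 U 1 w 0 := by
  obtain ⟨B⟩ := SteadyBlob.nonempty
  exact ⟨B.scheme, 1, fun x => (1 : ℝ) • B.G x, le_rfl, rfl, B.stepWithinB_one⟩

end Summit.NavierStokesRegularity.FluidComputer.TriggeredTransfer

end
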